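import Mathlib
import Summits.Ventures.LatticeQCDFlow.TrivializingMaps.AcceptanceFootprint
import Summits.Ventures.LatticeQCDFlow.TrivializingMaps.LightConeClustering
import Summits.Ventures.LatticeQCDFlow.TrivializingMaps.GeneratorLocality
import HarnessLib

/-!
# Depth × range of a layered strictly local flow proposal is bounded below at fixed acceptance

HONEST FRAMING: exact (Metropolis-corrected) sampling algorithms for lattice gauge theory; figures of merit are
autocorrelation/cost numbers at stated couplings and volumes; no continuum-physics claim.

Cell `lqcd-flow` (pub-lqcd), theory-1 (THEORY-1.md §28.6).  THEOREM Q (`AcceptanceFootprint`) in the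
coordinates the samplers of record are built in — PLAQUETTE BALLS `linkBall R e` and LAYERS:

* §1 `abs_cov_le_of_meanAccept_of_disjoint` — THEOREM Q with the separation hypothesis in READ-CLOSURE form
  (no metric): target `p·μ₀^ι`, proposal `Φ_* μ₀^ι = q·μ₀^ι`, read-sets `N`, equilibrium acceptance
  `≥ acc`, supports with disjoint read-closures ⇒ `|Cov_π(A,B)| ≤ 6 (1 - acc) a b`.
* §2 LAYERS ADD RANGES (`dependsOn_foldr_comp_linkBall`, `dependsOn_iterate_linkBall`): a composite of `k`
  field maps each of whose output links reads `linkBall R e` reads `linkBall (k R) e` (triangle inequality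
  `linkBall_add`); measurability of composites.
* §3 (`Gauge.…`) lattice gauge theory, `G = SU(n)`, target `𝒵⁻¹ e^{-S} D[U]`:
  `abs_cov_boltzmann_le_of_meanAccept_linkBall` (THEOREM Q, plaquette-ball form: range `r` ⇒ decorrelation
  at plaquette distance `> 2r`, i.e. `e' ∉ linkBall (2r) e`), `abs_cov_boltzmann_le_of_meanAccept_layers`
  (a proposal made of `k` layers of range `R`: decorrelation outside `linkBall (2kR)`), and the DEPTH LAW
  `exists_mem_linkBall_of_cov_gt_layers`: a target witness pair with `|Cov| > 6 (1 - acc) a b` forces the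
  supports to meet within `linkBall (2kR)` — at fixed acceptance, DEPTH × RANGE-PER-LAYER `kR ≥` half the
  plaquette distance of every such witness pair.
* §4 DOCKING TO LÜSCHER'S ORDER-`N` GENERATOR: a one-link update rule driven by the order-`N` truncated
  generator `∂S̃^{[N]}_t` at that link (`U_e ↦ f_e(∂S̃^{[N]}_t(U)_e, U_e)`, e.g. an Euler/stout step of any
  step size) reads `linkBall (2(N+1)) e` (`generatorLayer_dependsOn`, from the tree's
  `linkGrad_truncFlowAction_local`); hence `abs_cov_boltzmann_le_of_meanAccept_generatorLayers` and
  `exists_mem_linkBall_of_cov_gt_generatorLayers`: for an exact flow sampler whose proposal is `k` such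
  layers (any smooth Lüscher series for `β S_W`, any times, any rules) with acceptance `≥ acc`, every target
  witness pair above `6 (1 - acc) a b` lies within plaquette distance `4 k (N+1)`:
  **`k (N+1) ≥ dist_plaq / 4`** — the network-size law "depth × order versus coupling at fixed acceptance".

NOT claimed: any value of a correlation length; multi-stage (Runge–Kutta) steps are covered only through the
abstract layer theorems of §3 with their own range; nothing for continuous-time (quasi-local) proposals
(THEOREM C, `LightConeClustering`); no converse; no cost or training statement.

References: M. Lüscher, Commun. Math. Phys. 293 (2010) 899 [Luscher2010Trivializing] §3.2, §4.5(b), §5.1;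
THEORY-1.md §13.5 (PROPOSITION R), §28 (THEOREM Q).  Tags: [ours].
-/

namespace Summit.Ventures.LatticeQCDFlow.TrivializingMaps

open MeasureTheory Set
open scoped ENNReal

/-! ## §1. THEOREM Q in read-closure form -/

section ReadClosure

variable {ι : Type*} [Fintype ι] {α : Type*} [MeasurableSpace α]
variable (μ₀ : Measure α) [IsProbabilityMeasure μ₀]

/-- **THEOREM Q (read-closure form).**  Target `p · μ₀^ι`, proposal the push-forward `Φ_* μ₀^ι` with
density `q`, read-sets `N` (`Φ(W)(i)` depends only on `W` on `N i`), equilibrium acceptance `≥ acc`; then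
measurable `|A| ≤ a`, `|B| ≤ b` supported on `S`, `T` with DISJOINT READ-CLOSURES satisfy
`|∫ A B ∂π - (∫ A ∂π)(∫ B ∂π)| ≤ 6 (1 - acc) a b`. [ours] -/
theorem abs_cov_le_of_meanAccept_of_disjoint {p q : (ι → α) → ℝ} (hp0 : ∀ x, 0 ≤ p x)
    (hpm : Measurable p) (hpi : Integrable p (Measure.pi fun _ : ι => μ₀))
    (hp1 : ∫ x, p x ∂(Measure.pi fun _ : ι => μ₀) = 1) (hq0 : ∀ x, 0 ≤ q x) (hqm : Measurable q)
    (hqi : Integrable q (Measure.pi fun _ : ι => μ₀))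
    (hq1 : ∫ x, q x ∂(Measure.pi fun _ : ι => μ₀) = 1)
    {Φ : (ι → α) → (ι → α)} (hΦm : Measurable Φ)
    (hν : (Measure.pi fun _ : ι => μ₀).map Φ
      = (Measure.pi fun _ : ι => μ₀).withDensity fun x => ENNReal.ofReal (q x))
    {N : ι → Set ι} (hΦ : ∀ i, DependsOn (fun W => Φ W i) (N i)) {acc : ℝ}
    (hacc : acc ≤ ∫ x, ∫ y, min (p x * q y) (p y * q x) ∂(Measure.pi fun _ : ι => μ₀)
      ∂(Measure.pi fun _ : ι => μ₀))
    {A B : (ι → α) → ℝ} (hAm : Measurable A) (hBm : Measurable B) {a b : ℝ} (hAa : ∀ x, |A x| ≤ a)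
    (hBb : ∀ x, |B x| ≤ b) {S T : Set ι} (hA : DependsOn A S) (hB : DependsOn B T)
    (hdisj : Disjoint (readClosure N S) (readClosure N T)) :
    |∫ U, A U * B U ∂((Measure.pi fun _ : ι => μ₀).withDensity fun x => ENNReal.ofReal (p x))
        - (∫ U, A U ∂((Measure.pi fun _ : ι => μ₀).withDensity fun x => ENNReal.ofReal (p x)))
          * ∫ U, B U ∂((Measure.pi fun _ : ι => μ₀).withDensity fun x => ENNReal.ofReal (p x))|
      ≤ 6 * (1 - acc) * (a * b) := by
  have hfac := pushforward_integral_mul_eq μ₀ hΦm hΦ hAm hBm hA hB hdisj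
  rw [hν] at hfac
  exact abs_cov_le_of_meanAccept hp0 hpm hpi hp1 hq0 hqm hqi hq1 hacc hAm hBm hAa hBb hfac

end ReadClosure

/-! ## §2. Layers add ranges (plaquette balls) -/

section Layers

open Literature.MathematicalPhysics.QuantumFieldTheory
open Literature.MathematicalPhysics.QuantumFieldTheory.Luscher2010

variable {d L : ℕ} {G : Type*}

/-- Reading one's own link is range `R` for every `R`. [ours] -/
theorem dependsOn_eval_linkBall (R : ℕ) (e : Edge d L) :
    DependsOn (fun W : GaugeConfig d L G => W e) (linkBall R e) :=
  fun _ _ h => h e (self_mem_linkBall R e)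

/-- **LAYERS ADD RANGES.**  A composite `F₁ ∘ F₂ ∘ ⋯ ∘ F_k` (list, outermost first) of field maps each of
whose output links reads only `linkBall R e` reads only `linkBall (k R) e`. [ours] -/
theorem dependsOn_foldr_comp_linkBall {R : ℕ} :
    ∀ (Fs : List (GaugeConfig d L G → GaugeConfig d L G)),
      (∀ F ∈ Fs, ∀ e, DependsOn (fun W => F W e) (linkBall R e)) →
      ∀ e, DependsOn (fun W => (Fs.foldr (fun F acc => F ∘ acc) id) W e)
        (linkBall (Fs.length * R) e)
  | [], _, e => by simpa using dependsOn_eval_linkBall (G := G) 0 e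
  | F :: Fs, hFs, e => by
      intro W W' h
      simp only [List.foldr_cons, Function.comp_apply]
      apply hFs F (by simp) e
      intro e' he'
      refine dependsOn_foldr_comp_linkBall Fs (fun F' hF' => hFs F' (by simp [hF'])) e'
        (fun e'' he'' => h e'' ?_)
      exact linkBall_mono (le_of_eq (by simp only [List.length_cons]; ring)) _ (linkBall_add he' he'')

/-- **ITERATES ADD RANGES.**  `k` iterations of a range-`R` layer read `linkBall (k R) e`. [ours] -/
theorem dependsOn_iterate_linkBall {F : GaugeConfig d L G → GaugeConfig d L G} {R : ℕ}
    (hF : ∀ e, DependsOn (fun W => F W e) (linkBall R e)) :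
    ∀ (k : ℕ) (e : Edge d L), DependsOn (fun W => F^[k] W e) (linkBall (k * R) e)
  | 0, e => by simpa using dependsOn_eval_linkBall (G := G) 0 e
  | k + 1, e => by
      intro W W' h
      simp only [Function.iterate_succ_apply']
      apply hF e
      intro e' he'
      exact dependsOn_iterate_linkBall hF k e'
        (fun e'' he'' => h e'' (linkBall_mono (le_of_eq (by ring)) _ (linkBall_add he' he'')))

/-- Composites of measurable layers are measurable. [ours] -/
theorem measurable_foldr_comp [MeasurableSpace G] :
    ∀ (Fs : List (GaugeConfig d L G → GaugeConfig d L G)), (∀ F ∈ Fs, Measurable F) →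
      Measurable (Fs.foldr (fun F acc => F ∘ acc) id)
  | [], _ => measurable_id
  | F :: Fs, h => by
      simpa only [List.foldr_cons] using
        (h F (by simp)).comp (measurable_foldr_comp Fs fun F' hF' => h F' (by simp [hF']))

end Layers

/-! ## §3. Lattice gauge theory: plaquette-ball form, layered proposals, the depth law -/

namespace Gauge

open Literature.MathematicalPhysics.QuantumFieldTheory
open Literature.MathematicalPhysics.QuantumFieldTheory.Luscher2010
open scoped Matrix Matrix.Norms.Frobenius ContDiff

variable {d L n : ℕ} [NeZero L]

/-- **THEOREM Q, plaquette-ball form.**  `G = SU(n)`, continuous action `S`, target `𝒵⁻¹ e^{-S} D[U]`; a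
measurable proposal map `Φ` whose output link `e` reads only `linkBall r e`, with push-forward density `q`
against `D[U]` and equilibrium acceptance `≥ acc`.  Observables `|A| ≤ a`, `|B| ≤ b` on link sets `SA`, `SB`
at plaquette distance `> 2r` (`e' ∉ linkBall (2r) e`) have `|⟨AB⟩ - ⟨A⟩⟨B⟩| ≤ 6 (1 - acc) a b`. [ours] -/
theorem abs_cov_boltzmann_le_of_meanAccept_linkBall
    {S : GaugeConfig d L (Matrix.specialUnitaryGroup (Fin n) ℂ) → ℝ} (hS : Continuous S)
    {Φ : GaugeConfig d L (Matrix.specialUnitaryGroup (Fin n) ℂ) →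
      GaugeConfig d L (Matrix.specialUnitaryGroup (Fin n) ℂ)} (hΦm : Measurable Φ)
    {q : GaugeConfig d L (Matrix.specialUnitaryGroup (Fin n) ℂ) → ℝ} (hq0 : ∀ U, 0 ≤ q U)
    (hqm : Measurable q)
    (hν : (trivialMeasure (Matrix.specialUnitaryGroup (Fin n) ℂ) d L).map Φ
      = (trivialMeasure (Matrix.specialUnitaryGroup (Fin n) ℂ) d L).withDensity
          fun U => ENNReal.ofReal (q U))
    {r : ℕ} (hΦ : ∀ e, DependsOn (fun W => Φ W e) (linkBall r e)) {acc : ℝ}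
    (hacc : acc ≤ ∫ U, ∫ U', min (Real.exp (-S U) / (partitionFn S).toReal * q U')
        (Real.exp (-S U') / (partitionFn S).toReal * q U)
        ∂(trivialMeasure (Matrix.specialUnitaryGroup (Fin n) ℂ) d L)
        ∂(trivialMeasure (Matrix.specialUnitaryGroup (Fin n) ℂ) d L))
    {A B : GaugeConfig d L (Matrix.specialUnitaryGroup (Fin n) ℂ) → ℝ} (hAm : Measurable A)
    (hBm : Measurable B) {a b : ℝ} (hAa : ∀ U, |A U| ≤ a) (hBb : ∀ U, |B U| ≤ b)
    {SA SB : Set (Edge d L)} (hA : DependsOn A SA) (hB : DependsOn B SB)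
    (hsep : ∀ e ∈ SA, ∀ e' ∈ SB, e' ∉ linkBall (2 * r) e) :
    |∫ U, A U * B U ∂(boltzmannMeasure S)
        - (∫ U, A U ∂(boltzmannMeasure S)) * ∫ U, B U ∂(boltzmannMeasure S)|
      ≤ 6 * (1 - acc) * (a * b) := by
  obtain ⟨hp0, hpm, hpi, hp1⟩ := density_boltzmann_spec (d := d) (L := L) hS
  obtain ⟨hqi, hq1⟩ := integrable_of_map_eq_withDensity (d := d) (L := L) hΦm hq0 hqm hν
  rw [boltzmannMeasure_eq_withDensity hS]
  unfold trivialMeasure at hpi hp1 hqi hq1 hν hacc ⊢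
  exact abs_cov_le_of_meanAccept_of_disjoint (haarProbability (Matrix.specialUnitaryGroup (Fin n) ℂ))
    hp0 hpm hpi hp1 hq0 hqm hqi hq1 hΦm hν hΦ hacc hAm hBm hAa hBb hA hB
    (disjoint_readClosure_linkBall hsep)

/-- **THEOREM Q FOR LAYERED PROPOSALS.**  Same setting with the proposal map a composite
`F₁ ∘ ⋯ ∘ F_k` (list `Fs`, outermost first) of measurable layers each of range `R` in plaquette balls:
observables on link sets outside each other's `linkBall (2 k R)` have `|Cov_π| ≤ 6 (1 - acc) a b`. [ours] -/
theorem abs_cov_boltzmann_le_of_meanAccept_layers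
    {S : GaugeConfig d L (Matrix.specialUnitaryGroup (Fin n) ℂ) → ℝ} (hS : Continuous S)
    (Fs : List (GaugeConfig d L (Matrix.specialUnitaryGroup (Fin n) ℂ) →
      GaugeConfig d L (Matrix.specialUnitaryGroup (Fin n) ℂ)))
    (hFm : ∀ F ∈ Fs, Measurable F) {R : ℕ}
    (hFs : ∀ F ∈ Fs, ∀ e, DependsOn (fun W => F W e) (linkBall R e))
    {q : GaugeConfig d L (Matrix.specialUnitaryGroup (Fin n) ℂ) → ℝ} (hq0 : ∀ U, 0 ≤ q U)
    (hqm : Measurable q)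
    (hν : (trivialMeasure (Matrix.specialUnitaryGroup (Fin n) ℂ) d L).map
        (Fs.foldr (fun F acc => F ∘ acc) id)
      = (trivialMeasure (Matrix.specialUnitaryGroup (Fin n) ℂ) d L).withDensity
          fun U => ENNReal.ofReal (q U)) {acc : ℝ}
    (hacc : acc ≤ ∫ U, ∫ U', min (Real.exp (-S U) / (partitionFn S).toReal * q U')
        (Real.exp (-S U') / (partitionFn S).toReal * q U)
        ∂(trivialMeasure (Matrix.specialUnitaryGroup (Fin n) ℂ) d L)
        ∂(trivialMeasure (Matrix.specialUnitaryGroup (Fin n) ℂ) d L))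
    {A B : GaugeConfig d L (Matrix.specialUnitaryGroup (Fin n) ℂ) → ℝ} (hAm : Measurable A)
    (hBm : Measurable B) {a b : ℝ} (hAa : ∀ U, |A U| ≤ a) (hBb : ∀ U, |B U| ≤ b)
    {SA SB : Set (Edge d L)} (hA : DependsOn A SA) (hB : DependsOn B SB)
    (hsep : ∀ e ∈ SA, ∀ e' ∈ SB, e' ∉ linkBall (2 * (Fs.length * R)) e) :
    |∫ U, A U * B U ∂(boltzmannMeasure S)
        - (∫ U, A U ∂(boltzmannMeasure S)) * ∫ U, B U ∂(boltzmannMeasure S)|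
      ≤ 6 * (1 - acc) * (a * b) :=
  abs_cov_boltzmann_le_of_meanAccept_linkBall hS (measurable_foldr_comp Fs hFm) hq0 hqm hν
    (dependsOn_foldr_comp_linkBall Fs hFs) hacc hAm hBm hAa hBb hA hB hsep

/-- **DEPTH LAW AT FIXED ACCEPTANCE.**  Same setting; if a witness pair has connected correlation
`> 6 (1 - acc) a b` under the target, its supports MEET WITHIN `linkBall (2 k R)`: depth × range-per-layer
`k R` is at least half the plaquette distance of every such pair. [ours] -/
theorem exists_mem_linkBall_of_cov_gt_layers
    {S : GaugeConfig d L (Matrix.specialUnitaryGroup (Fin n) ℂ) → ℝ} (hS : Continuous S)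
    (Fs : List (GaugeConfig d L (Matrix.specialUnitaryGroup (Fin n) ℂ) →
      GaugeConfig d L (Matrix.specialUnitaryGroup (Fin n) ℂ)))
    (hFm : ∀ F ∈ Fs, Measurable F) {R : ℕ}
    (hFs : ∀ F ∈ Fs, ∀ e, DependsOn (fun W => F W e) (linkBall R e))
    {q : GaugeConfig d L (Matrix.specialUnitaryGroup (Fin n) ℂ) → ℝ} (hq0 : ∀ U, 0 ≤ q U)
    (hqm : Measurable q)
    (hν : (trivialMeasure (Matrix.specialUnitaryGroup (Fin n) ℂ) d L).map
        (Fs.foldr (fun F acc => F ∘ acc) id)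
      = (trivialMeasure (Matrix.specialUnitaryGroup (Fin n) ℂ) d L).withDensity
          fun U => ENNReal.ofReal (q U)) {acc : ℝ}
    (hacc : acc ≤ ∫ U, ∫ U', min (Real.exp (-S U) / (partitionFn S).toReal * q U')
        (Real.exp (-S U') / (partitionFn S).toReal * q U)
        ∂(trivialMeasure (Matrix.specialUnitaryGroup (Fin n) ℂ) d L)
        ∂(trivialMeasure (Matrix.specialUnitaryGroup (Fin n) ℂ) d L))
    {A B : GaugeConfig d L (Matrix.specialUnitaryGroup (Fin n) ℂ) → ℝ} (hAm : Measurable A)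
    (hBm : Measurable B) {a b : ℝ} (hAa : ∀ U, |A U| ≤ a) (hBb : ∀ U, |B U| ≤ b)
    {SA SB : Set (Edge d L)} (hA : DependsOn A SA) (hB : DependsOn B SB)
    (hcov : 6 * (1 - acc) * (a * b) < |∫ U, A U * B U ∂(boltzmannMeasure S)
        - (∫ U, A U ∂(boltzmannMeasure S)) * ∫ U, B U ∂(boltzmannMeasure S)|) :
    ∃ e ∈ SA, ∃ e' ∈ SB, e' ∈ linkBall (2 * (Fs.length * R)) e := by
  by_contra h
  push Not at h
  exact absurd (abs_cov_boltzmann_le_of_meanAccept_layers hS Fs hFm hFs hq0 hqm hν hacc hAm hBm hAa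
    hBb hA hB h) (not_le.2 hcov)

/-! ## §4. Docking: layers driven by Lüscher's order-`N` truncated generator -/

/-- **A ONE-LINK RULE DRIVEN BY THE ORDER-`N` GENERATOR READS `linkBall (2(N+1))`.**  For every smooth
solution `S̃^{(k)}` of Lüscher's recursion for `β S_W`, every `t`, `N`, and ANY rule
`f_e : (generator value at e, link at e) ↦ new link` (an Euler/stout step `U_e ↦ exp(h Z_e) U_e` of any
step size is one): the layer `U ↦ (e ↦ f_e(∂S̃^{[N]}_t(U)_e, U_e))` has range `2(N+1)` in plaquette balls
(tree `linkGrad_truncFlowAction_local`). [ours] -/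
theorem generatorLayer_dependsOn (B : SuBasis n) (β : ℝ) {Sk : ℕ → AmbConfig d L n → ℝ}
    {c : ℕ → ℝ} (hsm : ∀ k, ContDiff ℝ ∞ (Sk k))
    (hser : IsLuscherSeries B (fun W => β * ambWilsonAction W) Sk c) (t : ℝ) (N : ℕ)
    (f : Edge d L → Matrix (Fin n) (Fin n) ℂ → Matrix.specialUnitaryGroup (Fin n) ℂ →
      Matrix.specialUnitaryGroup (Fin n) ℂ) (e : Edge d L) :
    DependsOn (fun U : GaugeConfig d L (Matrix.specialUnitaryGroup (Fin n) ℂ) =>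
      f e (linkGrad B (truncFlowAction Sk t N) (WilsonFlow.coeConfig U) e) (U e))
      (linkBall (2 * (N + 1)) e) := by
  intro U U' h
  show f e _ (U e) = f e _ (U' e)
  rw [linkGrad_truncFlowAction_local B β hsm hser t N e h, h e (self_mem_linkBall _ e)]

/-- **THEOREM Q FOR `k` GENERATOR-DRIVEN LAYERS.**  `G = SU(n)`, continuous target action `S`; a proposal
that is a composite of `k` measurable layers (list `Fs`), each a one-link rule driven by the order-`N`
truncated generator of some smooth Lüscher series for `β S_W` at some time (`hgen`); push-forward density `q`,
equilibrium acceptance `≥ acc`.  Then observables on link sets at plaquette distance `> 4 k (N+1)`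
(`e' ∉ linkBall (2 (k · 2(N+1))) e`) have `|Cov_π(A,B)| ≤ 6 (1 - acc) a b`. [ours] -/
theorem abs_cov_boltzmann_le_of_meanAccept_generatorLayers
    {S : GaugeConfig d L (Matrix.specialUnitaryGroup (Fin n) ℂ) → ℝ} (hS : Continuous S)
    (B : SuBasis n) (β : ℝ) {Sk : ℕ → AmbConfig d L n → ℝ} {c : ℕ → ℝ}
    (hsm : ∀ k, ContDiff ℝ ∞ (Sk k)) (hser : IsLuscherSeries B (fun W => β * ambWilsonAction W) Sk c)
    (N : ℕ) (Fs : List (GaugeConfig d L (Matrix.specialUnitaryGroup (Fin n) ℂ) →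
      GaugeConfig d L (Matrix.specialUnitaryGroup (Fin n) ℂ)))
    (hFm : ∀ F ∈ Fs, Measurable F)
    (hgen : ∀ F ∈ Fs, ∃ (t : ℝ) (f : Edge d L → Matrix (Fin n) (Fin n) ℂ →
        Matrix.specialUnitaryGroup (Fin n) ℂ → Matrix.specialUnitaryGroup (Fin n) ℂ),
      ∀ U e, F U e = f e (linkGrad B (truncFlowAction Sk t N) (WilsonFlow.coeConfig U) e) (U e))
    {q : GaugeConfig d L (Matrix.specialUnitaryGroup (Fin n) ℂ) → ℝ} (hq0 : ∀ U, 0 ≤ q U)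
    (hqm : Measurable q)
    (hν : (trivialMeasure (Matrix.specialUnitaryGroup (Fin n) ℂ) d L).map
        (Fs.foldr (fun F acc => F ∘ acc) id)
      = (trivialMeasure (Matrix.specialUnitaryGroup (Fin n) ℂ) d L).withDensity
          fun U => ENNReal.ofReal (q U)) {acc : ℝ}
    (hacc : acc ≤ ∫ U, ∫ U', min (Real.exp (-S U) / (partitionFn S).toReal * q U')
        (Real.exp (-S U') / (partitionFn S).toReal * q U)
        ∂(trivialMeasure (Matrix.specialUnitaryGroup (Fin n) ℂ) d L)
        ∂(trivialMeasure (Matrix.specialUnitaryGroup (Fin n) ℂ) d L))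
    {A B' : GaugeConfig d L (Matrix.specialUnitaryGroup (Fin n) ℂ) → ℝ} (hAm : Measurable A)
    (hBm : Measurable B') {a b : ℝ} (hAa : ∀ U, |A U| ≤ a) (hBb : ∀ U, |B' U| ≤ b)
    {SA SB : Set (Edge d L)} (hA : DependsOn A SA) (hB : DependsOn B' SB)
    (hsep : ∀ e ∈ SA, ∀ e' ∈ SB, e' ∉ linkBall (2 * (Fs.length * (2 * (N + 1)))) e) :
    |∫ U, A U * B' U ∂(boltzmannMeasure S)
        - (∫ U, A U ∂(boltzmannMeasure S)) * ∫ U, B' U ∂(boltzmannMeasure S)|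
      ≤ 6 * (1 - acc) * (a * b) := by
  refine abs_cov_boltzmann_le_of_meanAccept_layers hS Fs hFm (R := 2 * (N + 1)) ?_ hq0 hqm hν hacc
    hAm hBm hAa hBb hA hB hsep
  intro F hF e
  obtain ⟨t, f, hFf⟩ := hgen F hF
  have hfun : (fun W => F W e) = fun W =>
      f e (linkGrad B (truncFlowAction Sk t N) (WilsonFlow.coeConfig W) e) (W e) :=
    funext fun W => hFf W e
  rw [hfun]
  exact generatorLayer_dependsOn B β hsm hser t N f e

/-- **DEPTH × ORDER LAW FOR THE FLOW SAMPLERS' PROPOSAL CLASS.**  Same setting; a target witness pair with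
connected correlation `> 6 (1 - acc) a b` has supports meeting within plaquette distance `4 k (N+1)`:
at fixed acceptance `acc`, `k (N+1) ≥ dist_plaq(witnesses) / 4` for EVERY witness pair of the target above
`6 (1 - acc) a b` — every volume, every coupling, every choice of times and one-link rules. [ours] -/
theorem exists_mem_linkBall_of_cov_gt_generatorLayers
    {S : GaugeConfig d L (Matrix.specialUnitaryGroup (Fin n) ℂ) → ℝ} (hS : Continuous S)
    (B : SuBasis n) (β : ℝ) {Sk : ℕ → AmbConfig d L n → ℝ} {c : ℕ → ℝ}
    (hsm : ∀ k, ContDiff ℝ ∞ (Sk k)) (hser : IsLuscherSeries B (fun W => β * ambWilsonAction W) Sk c)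
    (N : ℕ) (Fs : List (GaugeConfig d L (Matrix.specialUnitaryGroup (Fin n) ℂ) →
      GaugeConfig d L (Matrix.specialUnitaryGroup (Fin n) ℂ)))
    (hFm : ∀ F ∈ Fs, Measurable F)
    (hgen : ∀ F ∈ Fs, ∃ (t : ℝ) (f : Edge d L → Matrix (Fin n) (Fin n) ℂ →
        Matrix.specialUnitaryGroup (Fin n) ℂ → Matrix.specialUnitaryGroup (Fin n) ℂ),
      ∀ U e, F U e = f e (linkGrad B (truncFlowAction Sk t N) (WilsonFlow.coeConfig U) e) (U e))
    {q : GaugeConfig d L (Matrix.specialUnitaryGroup (Fin n) ℂ) → ℝ} (hq0 : ∀ U, 0 ≤ q U)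
    (hqm : Measurable q)
    (hν : (trivialMeasure (Matrix.specialUnitaryGroup (Fin n) ℂ) d L).map
        (Fs.foldr (fun F acc => F ∘ acc) id)
      = (trivialMeasure (Matrix.specialUnitaryGroup (Fin n) ℂ) d L).withDensity
          fun U => ENNReal.ofReal (q U)) {acc : ℝ}
    (hacc : acc ≤ ∫ U, ∫ U', min (Real.exp (-S U) / (partitionFn S).toReal * q U')
        (Real.exp (-S U') / (partitionFn S).toReal * q U)
        ∂(trivialMeasure (Matrix.specialUnitaryGroup (Fin n) ℂ) d L)
        ∂(trivialMeasure (Matrix.specialUnitaryGroup (Fin n) ℂ) d L))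
    {A B' : GaugeConfig d L (Matrix.specialUnitaryGroup (Fin n) ℂ) → ℝ} (hAm : Measurable A)
    (hBm : Measurable B') {a b : ℝ} (hAa : ∀ U, |A U| ≤ a) (hBb : ∀ U, |B' U| ≤ b)
    {SA SB : Set (Edge d L)} (hA : DependsOn A SA) (hB : DependsOn B' SB)
    (hcov : 6 * (1 - acc) * (a * b) < |∫ U, A U * B' U ∂(boltzmannMeasure S)
        - (∫ U, A U ∂(boltzmannMeasure S)) * ∫ U, B' U ∂(boltzmannMeasure S)|) :
    ∃ e ∈ SA, ∃ e' ∈ SB, e' ∈ linkBall (2 * (Fs.length * (2 * (N + 1)))) e := by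
  by_contra h
  push Not at h
  exact absurd (abs_cov_boltzmann_le_of_meanAccept_generatorLayers hS B β hsm hser N Fs hFm hgen hq0
    hqm hν hacc hAm hBm hAa hBb hA hB h) (not_le.2 hcov)

end Gauge

end Summit.Ventures.LatticeQCDFlow.TrivializingMaps
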